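import Summits.BirchSwinnertonDyer.BirchSwinnertonDyer.Theorems.TwoAdicConverseOrdLambdaHalfAtTwoBDPTwoVariableDefs
import Literature.NumberTheory.EllipticCurves.IntSeriesValueNormRigidity
import HarnessLib

set_option autoImplicit false

/-!
# Crux idea NODE for O2 `BDPSelmerLowerDivisibilityAtTwo` (item stmt-BirchSwinnertonDyer-24728) —
# «Greenberg value blow-up at 2» (lens: NEGATION at crux level + instrument)

Seat `cruxidea-stmt-BirchSwinnertonDyer-24728-1` GEN 4, round 1.  Companion card:
`Cruxes/BDPSelmerLowerDivisibilityAtTwo/Ideas/greenberg-value-blowup-two.md`; line card `Lines/greenberg_value_blowup_two.md`.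

QUESTION ASKED (negation lens): is O2 true AS TYPED?  O2's Greenberg frame `IsGreenbergLFunctionFree₂ … (classNumber K) LK G`
PRESCRIBES the values of the INTEGRAL series `G ∈ 𝒪_{ℂ₂}⟦T₁,T₂⟧` at every in-range character `ξ` (type `(−(m+1), n+1)`):
`G(pt ξ) = h_K · y · ι⁻¹(typeTwoInterpolationValueL 2 N v v̄ α ξ (−(n+1)) (m+1) ⟨θ,θ⟩ L(1))` with `y = LK(pt' ξ)` a value of
the Katz series.  Every value of an integral series at a point of the closed unit bidisc has norm `≤ 1` (§1).  Hence
(§2–§3, PROVED here, no `sorry`):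

* `greenberg_value_norm_le_one` — the frame BOUNDS its own prescribed values: `‖h_K · y · ι⁻¹(T)‖ ≤ 1`;
* `not_greenbergLowerInclusionAt_of_blowup` — if for EVERY Katz-frame solution `(Ω, δ, Ω₂, LK)` some in-range datum has
  `‖h_K · y · ι⁻¹(T)‖ > 1` (`GreenbergValueBlowupAt W K … 1`), then `¬ GreenbergLowerInclusionAt W K`;
* `not_bdpSelmerLowerDivisibilityAtTwo_of_blowup` — one habitat datum with blow-up refutes O2 (verdict would be
  `refuted-misstated`, repair = O2♭ `BDPSelmerLowerDivisibilityAtTwoRat` with slack `2^a`, `a >` the blow-up exponent;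
  the same hinge with threshold `c = 2^a` tests O2♭).

UNDECIDED PIECE (typed: `GreenbergValueBlowupAt W K ι v v̄ κ₁ κ₂ γ₁ γ₂ f 1` at ONE habitat datum) and its TEST — see the
line card: (A) the ARCHIMEDEAN OFFSET identity on the anticyclotomic line `ξ_n` of type `(2k, −2k)`:
`h_K · y_n · T(ξ_n) = 2^{c'n + d'} · (2-adic unit) · 𝒬_n`, `𝒬_n` = square of the integral CM toric period of `θ^{n−1} f^♭`
(explicit Waldspurger, Castella–Hsieh Prop. 3.4/3.6; Hida's adjoint formula; de Shalit's functional equation) — this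
session's bookkeeping gives the CERTIFICATE `c' = 0` (no n-linear 2-drift; CGS's printed `2^{3n−2}` in the proof of
Prop. 1.4.5 of arXiv:2303.04373 is not reproduced by their displayed formulas) and leaves the SIGN of the absolute constant
`d' = −(4 + #A) + δ_Hida + δ_FE + δ_CNF` to three exact printed constants; (U) one UNIT WITNESS `v₂(𝒬_n) < −d'` for a
habitat curve (rational 2-torsion, good ordinary at 2; Kriz–Li-type Heegner-log valuation).  `d' + min v₂(𝒬_n) < 0` at one
habitat datum ⟹ blow-up ⟹ ¬O2.  `d' ≥ 0` ⟹ the anticyclotomic line carries no obstruction (certificate) and F-O2-int must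
look off that line.

Honours `Cruxes/OrdLambdaHalfAtTwo/Disproof.lean`: uses no refuted strengthening; the blow-up datum is quantified over ALL
Katz-frame solutions (the frame's `∃ (Ω, δ, Ω₂)` enters only the Katz slot), so no period choice is smuggled.
References: [cite: YanZhu2024MainConjNonCM, Def. 3.10, Thm. 3.8–3.9 (arXiv:2412.20078v4)]
[cite: CastellaGrossiSkinner2025, Thm. 1.4.1, Thm. 1.4.2, Def. 1.4.3, Prop. 1.4.5 (arXiv:2303.04373 §1.4)]
[cite: CastellaHsieh2018, Prop. 3.4, Prop. 3.6, Thm. 3.7 (arXiv:1505.08165 §3)] [cite: KrizLi2019, §7 (doi:10.1017/fms.2019.9)]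
[cite: Gouvea1993PadicNumbers, §5.6]
-/

noncomputable section

open scoped Classical NumberField
open WeierstrassCurve NumberField IsDedekindDomain Field PowerSeries CongruenceSubgroup
open Literature.NumberTheory.EllipticCurves Literature.NumberTheory.EllipticCurves.Rank1Residual
open Literature.NumberTheory.EllipticCurves.ModularForms
open Literature.NumberTheory.GaloisRepresentations
open Literature.NumberTheory.EllipticCurves.YanZhu2026
open Summit.BirchSwinnertonDyer.BirchSwinnertonDyer.Theorems.TwoAdicKatoDeterminant

namespace Summit.BirchSwinnertonDyer.BirchSwinnertonDyer.Cruxes.BDPSelmerLowerDivisibilityAtTwo.GreenbergValueBlowupTwo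

/-! ## §1 Kernel: values of an integral two-variable series are integral -/

/-- `‖a − 1‖ ≤ 1` when `‖a‖ ≤ 1` (ultrametric). [cite: Gouvea1993PadicNumbers, §5.6] -/
theorem norm_sub_one_le_one {p : ℕ} [Fact p.Prime] {a : ℂ_[p]} (ha : ‖a‖ ≤ 1) : ‖a - 1‖ ≤ 1 := by
  rw [sub_eq_add_neg]
  exact (IsUltrametricDist.norm_add_le_max _ _).trans (max_le ha (by rw [norm_neg, norm_one]))

/-- **Values of `G ∈ 𝒪_{ℂ_p}⟦T₁,T₂⟧` at points of the closed unit bidisc have norm `≤ 1`** (two-variable twin of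
`IntSeries.norm_value_le_one`: every term `c_{ij} xⁱ yʲ` has norm `≤ 1`, ultrametric `tsum` bound).
[cite: Gouvea1993PadicNumbers, §5.6] [cite: deShalit1987, II.4.17 (54)] -/
theorem norm_value₂_le_one {p : ℕ} [Fact p.Prime] {G : PowerSeries (PowerSeries (PadicComplexInt p))}
    {x y w : ℂ_[p]} (hx : ‖x‖ ≤ 1) (hy : ‖y‖ ≤ 1) (hw : IntSeries.HasValueAt₂ G x y w) : ‖w‖ ≤ 1 := by
  rw [← hw.tsum_eq]
  refine IsUltrametricDist.norm_tsum_le_of_forall_le_of_nonneg zero_le_one fun k ↦ ?_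
  rw [norm_mul, norm_mul, norm_pow, norm_pow]
  exact mul_le_one₀ (mul_le_one₀ (norm_coe_padicComplexInt_le_one _) (pow_nonneg (norm_nonneg _) _)
    (pow_le_one₀ (norm_nonneg _) hx)) (pow_nonneg (norm_nonneg _) _) (pow_le_one₀ (norm_nonneg _) hy)

/-! ## §2 The Greenberg frame bounds its own prescribed values -/

variable {K : Type} [Field K] [NumberField K] [IsCMField K]

/-- **`‖h_K · y · ι⁻¹(T(ξ))‖ ≤ 1` for every in-range datum of the coordinate-free Greenberg frame** — the prescribed value
is a value of the integral series `G` at the point `(r(g₁) − 1, r(g₂) − 1)` of the closed unit bidisc.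
[cite: YanZhu2024MainConjNonCM, Def. 3.11 with Thm. 3.9 (arXiv:2412.20078v4 TeX l.839–871)] [cite: Gouvea1993PadicNumbers, §5.6] -/
theorem greenberg_value_norm_le_one {p : ℕ} [Fact p.Prime] {N : ℕ} {ι : PadicAlgCl p ≃+* ℂ}
    {v vbar : HeightOneSpectrum (𝓞 K)} {κ₁ κ₂ : ZpExtension K p} {g₁ g₂ : absoluteGaloisGroup K}
    {f : CuspForm (Gamma0 N) 2} {D : ℕ} [NeZero D] {hK : ℕ} {LK G : PowerSeries (PowerSeries (PadicComplexInt p))}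
    (h : IsGreenbergLFunctionFree₂ ι v vbar κ₁ κ₂ g₁ g₂ f D hK LK G)
    {ξ : HeckeCharacter K} {r r' : FramedGaloisRep K (PadicAlgCl p) 1} {m n : ℕ} {α : ℂ}
    (hr : IsPAdicAvatarOf ι ξ r) (hκ : FactorsThroughPair κ₁ κ₂ r)
    (hr' : IsPAdicAvatarOf ι (ξ / HeckeCharacter.galConj (IsCMField.complexConj K) ξ) r')
    (hunr : ∀ w : HeightOneSpectrum (𝓞 K), ξ.IsUnramifiedAt w)
    (hinf : ξ.HasInfinityType (fun _ ↦ -((m : ℤ) + 1)) (fun _ ↦ (n : ℤ) + 1))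
    (hα : α ^ 2 - cuspCoeff f p * α + p = 0) {θ : CuspForm (Gamma1 D) ((m + n + 3 : ℕ) : ℤ)}
    (hθ : IsCMNewformOf (ξ / HeckeCharacter.normCharacter K ^ (m + 1)) θ)
    {L : ℂ → ℂ} (hL : Differentiable ℂ L)
    (hL' : ∀ s : ℂ, (m : ℝ) + n + 3 < s.re → L s = rankinSelbergEulerProductHecke f ξ s)
    {y : ℂ_[p]} (hy : IntSeries.HasValueAt₂ LK (avatarValueAt r' g₁ - 1) (avatarValueAt r' g₂ - 1) y)
    (h₁ : ‖avatarValueAt r g₁‖ ≤ 1) (h₂ : ‖avatarValueAt r g₂‖ ≤ 1) :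
    ‖(hK : ℂ_[p]) * y *
        ((ι.symm (typeTwoInterpolationValueL p N v vbar α ξ (-((n : ℤ) + 1)) ((m : ℤ) + 1)
            (cmPeterssonNormSq θ) (L 1)) : PadicAlgCl p) : ℂ_[p])‖ ≤ 1 :=
  norm_value₂_le_one (norm_sub_one_le_one h₁) (norm_sub_one_le_one h₂)
    (h.hasValueAt₂ hr hκ hr' hunr hinf hα hθ hL hL' hy)

/-! ## §3 The typed obstruction and the hinge to `¬ O2` -/

/-- **UNDECIDED PIECE `GreenbergValueBlowupAt W K ι v v̄ κ₁ κ₂ γ₁ γ₂ f c`** — for EVERY solution `(Ω ≠ 0, δ² = ±d_K, Ω₂, LK)`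
of O2's Katz slot (`IsKatzMeasure₂ ι v v̄ ∅ κ₁ κ₂ γ₁⁻¹ γ₂⁻¹ 1 Ω δ Ω₂ LK`) there is an in-range datum of the Greenberg frame
(`ξ` unramified of type `(−(m+1), n+1)` with avatars `r`, `r'` of `ξ`, `ξ/ξ^τ`, a root `α`, the CM newform `θ`, an entire
continuation `L`, and the Katz value `y = LK(pt' ξ)`) whose prescribed Greenberg value has norm `> c`:
`c < ‖h_K · y · ι⁻¹(typeTwoInterpolationValueL 2 N v v̄ α ξ (−(n+1)) (m+1) ⟨θ,θ⟩ (L 1))‖`.  With `c = 1` this is the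
negation target of O2 at the datum; with `c = 2^a` that of O2♭ with slack `a`.  TEST (line card §A, §U): the anticyclotomic
offset `d'` (three exact printed constants) and one unit witness `v₂(𝒬_n) < −d'`.  A `Prop`; nothing asserted.
[cite: YanZhu2024MainConjNonCM, Def. 3.10–3.11, Thm. 3.8–3.9 (arXiv:2412.20078v4)]
[cite: CastellaHsieh2018, Prop. 3.6 (arXiv:1505.08165 §3.4)] -/
def GreenbergValueBlowupAt (W : WeierstrassCurve ℚ) [W.IsElliptic] [W.IsGloballyMinimal]
    (K : Type) [Field K] [NumberField K] [IsCMField K] (ι : PadicAlgCl 2 ≃+* ℂ)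
    (v vbar : HeightOneSpectrum (𝓞 K)) (κ₁ κ₂ : ZpExtension K 2) (γ₁ γ₂ : absoluteGaloisGroup K)
    [NeZero (W.conductorNorm ℤ)] (f : CuspForm (Gamma0 (W.conductorNorm ℤ)) 2)
    [NeZero (NumberField.discr K).natAbs] (c : ℝ) : Prop :=
  ∀ (Ω δ : ℂ) (Ωp : (unrIntegers 2)ˣ) (LK : PowerSeries (PowerSeries (PadicComplexInt 2))),
    Ω ≠ 0 → (δ ^ 2 = (NumberField.discr K : ℂ) ∨ δ ^ 2 = -(NumberField.discr K : ℂ)) →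
    IsKatzMeasure₂ ι v vbar ∅ κ₁ κ₂ γ₁⁻¹ γ₂⁻¹ 1 Ω δ ((Ωp : unrIntegers 2) : ℂ_[2]) LK →
    ∃ (ξ : HeckeCharacter K) (r r' : FramedGaloisRep K (PadicAlgCl 2) 1) (m n : ℕ) (α : ℂ)
      (θ : CuspForm (Gamma1 (NumberField.discr K).natAbs) ((m + n + 3 : ℕ) : ℤ)) (L : ℂ → ℂ) (y : ℂ_[2]),
      IsPAdicAvatarOf ι ξ r ∧ FactorsThroughPair κ₁ κ₂ r ∧
      IsPAdicAvatarOf ι (ξ / HeckeCharacter.galConj (IsCMField.complexConj K) ξ) r' ∧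
      (∀ w : HeightOneSpectrum (𝓞 K), ξ.IsUnramifiedAt w) ∧
      ξ.HasInfinityType (fun _ ↦ -((m : ℤ) + 1)) (fun _ ↦ (n : ℤ) + 1) ∧
      α ^ 2 - cuspCoeff f 2 * α + (2 : ℕ) = 0 ∧
      IsCMNewformOf (ξ / HeckeCharacter.normCharacter K ^ (m + 1)) θ ∧
      Differentiable ℂ L ∧ (∀ s : ℂ, (m : ℝ) + n + 3 < s.re → L s = rankinSelbergEulerProductHecke f ξ s) ∧
      IntSeries.HasValueAt₂ LK (avatarValueAt r' γ₁⁻¹ - 1) (avatarValueAt r' γ₂⁻¹ - 1) y ∧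
      ‖avatarValueAt r γ₁⁻¹‖ ≤ 1 ∧ ‖avatarValueAt r γ₂⁻¹‖ ≤ 1 ∧
      c < ‖(NumberField.classNumber K : ℂ_[2]) * y *
        ((ι.symm (typeTwoInterpolationValueL 2 (W.conductorNorm ℤ) v vbar α ξ (-((n : ℤ) + 1)) ((m : ℤ) + 1)
            (cmPeterssonNormSq θ) (L 1)) : PadicAlgCl 2) : ℂ_[2])‖

/-- **HINGE: blow-up (threshold `c ≥ 1`) at the datum refutes O2's body `GreenbergLowerInclusionAt W K`.**  Unfold O2 at the
datum, feed its Katz witness to the blow-up hypothesis, and compare the frame's bound `≤ 1` (§2) with `> c ≥ 1`.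
[cite: YanZhu2024MainConjNonCM, Thm. 4.2 (2) (arXiv:2412.20078v4 TeX l.932–949)] [cite: Gouvea1993PadicNumbers, §5.6] -/
theorem not_greenbergLowerInclusionAt_of_blowup (W : WeierstrassCurve ℚ) [W.IsElliptic] [W.IsGloballyMinimal]
    (K : Type) [Field K] [NumberField K] [IsCMField K] (ι : PadicAlgCl 2 ≃+* ℂ)
    (v vbar : HeightOneSpectrum (𝓞 K)) (κ₁ κ₂ : ZpExtension K 2) (γ₁ γ₂ : absoluteGaloisGroup K)
    [Fact (ZpExtension.IsTopGeneratorPair κ₁ κ₂ γ₁ γ₂)] [NeZero (W.conductorNorm ℤ)]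
    (f : CuspForm (Gamma0 (W.conductorNorm ℤ)) 2) (hf : ModularForms.IsNewformOf W f)
    [NeZero (NumberField.discr K).natAbs]
    (h2v : ((2 : ℕ) : 𝓞 K) ∈ v.asIdeal) (h2vbar : ((2 : ℕ) : 𝓞 K) ∈ vbar.asIdeal) (hne : vbar ≠ v)
    (hι : ∀ (w : InfinitePlace K) (k : 𝓞 K), k ∈ v.asIdeal ↔ ‖ι.symm (w.embedding (k : K))‖ < 1)
    {c : ℝ} (hc : 1 ≤ c) (hB : GreenbergValueBlowupAt W K ι v vbar κ₁ κ₂ γ₁ γ₂ f c) :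
    ¬ GreenbergLowerInclusionAt W K := by
  intro h
  obtain ⟨Ω, δ, Ωp, LK, G, hΩ, hδ, hKatz, hGr, -, -⟩ := h ι v vbar κ₁ κ₂ γ₁ γ₂ f hf h2v h2vbar hne hι
  obtain ⟨ξ, r, r', m, n, α, θ, L, y, hr, hκ, hr', hunr, hinf, hα, hθ, hL, hL', hy, h₁, h₂, hgt⟩ :=
    hB Ω δ Ωp LK hΩ hδ hKatz
  have hle := greenberg_value_norm_le_one hGr hr hκ hr' hunr hinf hα hθ hL hL' hy h₁ h₂
  exact (not_lt.mpr hle) (lt_of_le_of_lt hc hgt)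

/-- **One habitat datum with blow-up refutes O2 `BDPSelmerLowerDivisibilityAtTwo`** (the route item, BY NAME).  Were the
undecided piece to hold at a single `(W, K, ι, v, v̄, κ₁, κ₂, γ₁, γ₂, f)` of O2's habitat (non-CM, good ordinary at `2`,
`E[2]` reducible, `K` imaginary quadratic Heegner for `2N`), O2 would be `refuted-misstated` and O2♭ (rational frame with
slack) its repair. [cite: YanZhu2024MainConjNonCM, Thm. 4.2 (2) (arXiv:2412.20078v4)] -/
theorem not_bdpSelmerLowerDivisibilityAtTwo_of_blowup (W : WeierstrassCurve ℚ) [W.IsElliptic] [W.IsGloballyMinimal]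
    (hCM : ¬ W.HasCM) (hord : GoodOrd W 2) (hred : ¬ W.HasIrreducibleModPGaloisRep 2)
    (K : Type) [Field K] [NumberField K] [IsCMField K]
    (hK : IsImaginaryQuadratic K ∧ SatisfiesHeegnerHypothesis (2 * W.conductorNorm ℤ) K)
    (ι : PadicAlgCl 2 ≃+* ℂ) (v vbar : HeightOneSpectrum (𝓞 K)) (κ₁ κ₂ : ZpExtension K 2)
    (γ₁ γ₂ : absoluteGaloisGroup K) [Fact (ZpExtension.IsTopGeneratorPair κ₁ κ₂ γ₁ γ₂)] [NeZero (W.conductorNorm ℤ)]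
    (f : CuspForm (Gamma0 (W.conductorNorm ℤ)) 2) (hf : ModularForms.IsNewformOf W f)
    [NeZero (NumberField.discr K).natAbs]
    (h2v : ((2 : ℕ) : 𝓞 K) ∈ v.asIdeal) (h2vbar : ((2 : ℕ) : 𝓞 K) ∈ vbar.asIdeal) (hne : vbar ≠ v)
    (hι : ∀ (w : InfinitePlace K) (k : 𝓞 K), k ∈ v.asIdeal ↔ ‖ι.symm (w.embedding (k : K))‖ < 1)
    (hB : GreenbergValueBlowupAt W K ι v vbar κ₁ κ₂ γ₁ γ₂ f 1) :
    ¬ BDPSelmerLowerDivisibilityAtTwo := fun h ↦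
  not_greenbergLowerInclusionAt_of_blowup W K ι v vbar κ₁ κ₂ γ₁ γ₂ f hf h2v h2vbar hne hι le_rfl hB
    (h W hCM hord hred K hK)

end Summit.BirchSwinnertonDyer.BirchSwinnertonDyer.Cruxes.BDPSelmerLowerDivisibilityAtTwo.GreenbergValueBlowupTwo

end
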